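import Mathlib
import HarnessLib
import Literature.Computability.AlgebraicComplexity.StrassenPreorder
import Literature.Computability.AlgebraicComplexity.StrassenPreorderRank
import Literature.Computability.AlgebraicComplexity.StrassenPreorderSubrank
import Literature.Computability.AlgebraicComplexity.StrassenSpectralTheorem

/-!
# OutsiderSandwich — FACE LOCALISATION in a Strassen preorder, I: integer normal forms of face
inequalities and the LINEAR catalytic normal form on the top fibre
(decomp-mm lens 4 «minimal counterexample / extremal reduction», gen 35, part 1/3: abstract theory)

Route `route-MatrixMultiplication-OutsiderSandwich`; cut of record UNCHANGED:
`closes (h₁ : LaserTangency) (h₂ : LaserMergeOptimal) (h₃ : SummitIffLaserTangency) : ω(ℂ) = 2`,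
`LaserMergeOptimal` (stmt-27897) the declared residual.  Theorem-only, definition-free support;
continues gen 34 part 1 (`OutsiderSandwichTopFibre`: the top fibre `{φ(a) = R̃(a)}`).

THE OBJECT.  `≼` a Strassen preorder on a commutative semiring `S` (Zuiddam 2018 §2), `X` its
asymptotic spectrum (compact, Zuiddam Thm. 2.15), `u ≼~ v` (`AsympLe`) a VALID inequality, i.e.
`φ(u) ≤ φ(v)` on `X` (Zuiddam Thm. 2.12).  Its **face** is `Z(u,v) = {φ ∈ X : φ(u) = φ(v)}` — the zero
set of the non-negative continuous DEFECT `φ(v) − φ(u)`.  (Part 3: `S = T(ℂ)`, `u = 27[⟨2,2,2⟩]`,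
`v = 4[cw₂]³`, the laser floor; its face = the laser-TIGHT universal spectral points.)

§1 **Topological core** (`exists_multiplier_of_zeroSetLe`, `exists_multipliers_of_zeroSetLt`): for ANY
   continuous `g ≥ 0` on `X`, an inequality `φ(x) ≤ φ(y)` (resp. `<`) valid on `{g = 0}` extends to all
   of `X` as `φ(x) ≤ φ(y) + n·g(φ) + 1` (resp. `k·φ(x) + 1 ≤ k·φ(y) + n·g(φ)`) with natural
   multipliers: compactness of the bad set + the rank bound `φ(x) ≤ R(x)`.  (g34's
   `exists_gap_of_topLe` is the case `g = R̃(a) − φ(a)`.)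

§2 **Faces of valid inequalities: integer normal forms** (`faceLe_iff_family`, `faceLt_iff_family`):
     `(∀ φ ∈ Z(u,v), φ(x) ≤ φ(y)) ⟺ ∀ k ∃ n, k·x + n·u ≼~ k·y + n·v + 1`,
     `(∀ φ ∈ Z(u,v), φ(x) < φ(y)) ⟺ ∃ k n, k·x + n·u + 1 ≼~ k·y + n·v`
   — localisation to a face costs ONE natural multiplier `n` of the defining inequality and NO
   irrational price (contrast g34: the top fibre `{φ(a) = R̃(a)}` needs the refund price `R̃(a)`).

§3 **LINEAR catalytic normal form on the top fibre** (critic g34 SHARPEN s1; `topLt_iff_linear`,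
   `topLt_iff_linear_catalytic`): for STRICT top-fibre inequalities the catalyst of g34 can be taken
   LINEAR in the level, with ONE pair `(n, L)` for all levels `k`:
     `(∀ top φ, φ(x) < φ(y)) ⟺ ∃ n L, ∀ φ ∈ X, n·φ(x) + L·φ(a) + 1 ≤ n·φ(y) + L·R̃(a)`
                            `⟺ ∃ n L, ∀ k, ∃ r ≤ L·k·R̃(a) + 2, k(n·x + 1) + (L·k)·a ≼~ k·n·y + r`.
   (For NON-strict inequalities linearity fails in general — the defect may vanish to higher order at
   the fibre — which is why g34's `topLe_iff_catalytic` keeps `∃ l` per level.)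

Part 2 (`OutsiderSandwichFaceCertificates`): certificates `(p,q,n)`, the MAX FORMULA on a face
`max_Z φ(x) = inf{p/q : q·x + n·u ≼~ p + n·v}` and the face-vs-top-fibre SUBSIDY criterion.

Nearest prior art (searched g34/g35: corpus fts+vec "Vergleichsstellensatz face localisation",
"asymptotic spectrum closed subset extended preorder", galaxy "Vergleichsstellensatz|catalytic|zig-zag"):
Alman–Li–Pratt 2026 (arXiv:2604.01386) §3 Prop. 3.3 / Lemma 3.3 (closed subsets `{φ ≥ f}` of `X` are
spectra of extended preorders `≼_f`, zig-zag normal form) with Wigderson–Zuiddam 2023 Thm. 3.26;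
Bugár–Vrana 2025 Thm. 3.23.  Delta: for the face of ONE valid inequality the localised spectral theorem
has a ONE-MULTIPLIER integer normal form inside the original `≼~`, from compactness + the rank bound.

References: [cite: Zuiddam2018, Def. 2.1, Thm. 2.12, Cor. 2.13, Thm. 2.15]; [cite: Strassen1988,
Thm. 2.3–2.4, Thm. 3.8]; Alman–Li–Pratt, arXiv:2604.01386 (2026) §3; Wigderson–Zuiddam, *Asymptotic
spectra* (2023) §3 [WigdersonZuiddam2023].
-/

set_option linter.dupNamespace false

namespace Summit.MatrixMultiplication.MatrixMultiplication.Theorems.OutsiderSandwichFaceLocalisation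

open Literature.Computability.AlgebraicComplexity

universe u

variable {S : Type u} [CommSemiring S] {le : S → S → Prop}

/-! ## §1  Topological core: localisation to the zero set of a non-negative continuous function -/

/-- **Core, non-strict.**  If `g ≥ 0` is continuous on the spectrum and `φ(x) ≤ φ(y)` on `{g = 0}`,
then `φ(x) ≤ φ(y) + n·g(φ) + 1` on all of `X` for some `n ∈ ℕ` (the compact bad set
`{φ(y) + 1 ≤ φ(x)}` misses `{g = 0}`, so `g ≥ δ > 0` on it, and `φ(x) ≤ R(x)` fixes `n`).
[cite: Zuiddam2018, Thm. 2.15] -/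
theorem exists_multiplier_of_zeroSetLe (h : IsStrassenPreorder le) {g : (S → ℝ) → ℝ}
    (hg : Continuous g) (hg0 : ∀ φ, IsSpectralPoint le φ → 0 ≤ g φ) {x y : S}
    (H : ∀ φ, IsSpectralPoint le φ → g φ = 0 → φ x ≤ φ y) :
    ∃ n : ℕ, ∀ φ, IsSpectralPoint le φ → φ x ≤ φ y + n * g φ + 1 := by
  have hK : IsCompact ({φ : S → ℝ | IsSpectralPoint le φ} ∩ {φ | φ y + 1 ≤ φ x}) :=
    h.isCompact_setOf_isSpectralPoint.inter_right
      (isClosed_le ((continuous_apply y).add continuous_const) (continuous_apply x))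
  by_cases hne : ({φ : S → ℝ | IsSpectralPoint le φ} ∩ {φ | φ y + 1 ≤ φ x}).Nonempty
  · obtain ⟨φ₀, hφ₀, hmin⟩ := hK.exists_isMinOn hne hg.continuousOn
    have hgne : g φ₀ ≠ 0 := by
      intro h0
      have h1 := H φ₀ hφ₀.1 h0
      have h2 : φ₀ y + 1 ≤ φ₀ x := hφ₀.2
      linarith
    have hδ : 0 < g φ₀ := lt_of_le_of_ne (hg0 φ₀ hφ₀.1) (Ne.symm hgne)
    obtain ⟨n, hn⟩ : ∃ n : ℕ, (rankOf le x : ℝ) ≤ n * g φ₀ := by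
      obtain ⟨n, hn⟩ := exists_nat_ge ((rankOf le x : ℝ) / g φ₀)
      exact ⟨n, by rwa [div_le_iff₀ hδ] at hn⟩
    refine ⟨n, fun φ hφ => ?_⟩
    have hxR : φ x ≤ rankOf le x := hφ.le_rankOf h x
    have hy0 : 0 ≤ φ y := hφ.nonneg h y
    have hn0 : (0 : ℝ) ≤ n := Nat.cast_nonneg n
    have hgφ : 0 ≤ g φ := hg0 φ hφ
    by_cases hc : φ y + 1 ≤ φ x
    · have hmem : φ ∈ {φ : S → ℝ | IsSpectralPoint le φ} ∩ {φ | φ y + 1 ≤ φ x} := ⟨hφ, hc⟩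
      have h3 : g φ₀ ≤ g φ := hmin hmem
      have h4 : (n : ℝ) * g φ₀ ≤ n * g φ := mul_le_mul_of_nonneg_left h3 hn0
      linarith
    · push Not at hc
      have h5 : (0 : ℝ) ≤ n * g φ := mul_nonneg hn0 hgφ
      linarith
  · refine ⟨0, fun φ hφ => ?_⟩
    have hc : ¬ (φ y + 1 ≤ φ x) := fun hc => hne ⟨φ, hφ, hc⟩
    push Not at hc
    rw [Nat.cast_zero, zero_mul, add_zero]
    exact hc.le

/-- **Core, strict.**  If `g ≥ 0` is continuous on the spectrum and `φ(x) < φ(y)` on `{g = 0}`, then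
`k·φ(x) + 1 ≤ k·φ(y) + n·g(φ)` on all of `X` for some `k, n ∈ ℕ` (compactness twice: a uniform
strictness constant `k` on the zero set, then the non-strict core on the bad set `{k·φ(y) ≤ k·φ(x)+1}`).
[cite: Zuiddam2018, Thm. 2.15] -/
theorem exists_multipliers_of_zeroSetLt (h : IsStrassenPreorder le) {g : (S → ℝ) → ℝ}
    (hg : Continuous g) (hg0 : ∀ φ, IsSpectralPoint le φ → 0 ≤ g φ) {x y : S}
    (H : ∀ φ, IsSpectralPoint le φ → g φ = 0 → φ x < φ y) :
    ∃ k n : ℕ, ∀ φ, IsSpectralPoint le φ → (k : ℝ) * φ x + 1 ≤ k * φ y + n * g φ := by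
  -- Step 1: a uniform strictness constant `k` on the zero set (compact)
  have hZ : IsCompact ({φ : S → ℝ | IsSpectralPoint le φ} ∩ {φ | g φ = 0}) :=
    h.isCompact_setOf_isSpectralPoint.inter_right (isClosed_eq hg continuous_const)
  obtain ⟨k, hk⟩ : ∃ k : ℕ, ∀ φ, IsSpectralPoint le φ → g φ = 0 → 2 ≤ (k : ℝ) * (φ y - φ x) := by
    by_cases hne : ({φ : S → ℝ | IsSpectralPoint le φ} ∩ {φ | g φ = 0}).Nonempty
    · obtain ⟨φ₁, hφ₁, hmin⟩ := hZ.exists_isMinOn hne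
        ((continuous_apply y).sub (continuous_apply x)).continuousOn
      have hη : 0 < φ₁ y - φ₁ x := sub_pos.2 (H φ₁ hφ₁.1 hφ₁.2)
      obtain ⟨k, hk⟩ := exists_nat_ge (2 / (φ₁ y - φ₁ x))
      refine ⟨k, fun φ hφ hφ0 => ?_⟩
      have h1 : φ₁ y - φ₁ x ≤ φ y - φ x :=
        hmin (⟨hφ, hφ0⟩ : φ ∈ {φ : S → ℝ | IsSpectralPoint le φ} ∩ {φ | g φ = 0})
      have h2 : 2 ≤ (k : ℝ) * (φ₁ y - φ₁ x) := by rwa [div_le_iff₀ hη] at hk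
      have hk0 : (0 : ℝ) ≤ k := Nat.cast_nonneg k
      linarith [mul_le_mul_of_nonneg_left h1 hk0]
    · exact ⟨0, fun φ hφ hφ0 => absurd ⟨φ, hφ, hφ0⟩ hne⟩
  -- Step 2: the bad set `{k φ(y) ≤ k φ(x) + 1}` is compact and misses the zero set
  have hC : IsCompact ({φ : S → ℝ | IsSpectralPoint le φ} ∩
      {φ | (k : ℝ) * φ y ≤ (k : ℝ) * φ x + 1}) :=
    h.isCompact_setOf_isSpectralPoint.inter_right
      (isClosed_le (continuous_const.mul (continuous_apply y))
        ((continuous_const.mul (continuous_apply x)).add continuous_const))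
  by_cases hne : ({φ : S → ℝ | IsSpectralPoint le φ} ∩
      {φ | (k : ℝ) * φ y ≤ (k : ℝ) * φ x + 1}).Nonempty
  · obtain ⟨φ₀, hφ₀, hmin⟩ := hC.exists_isMinOn hne hg.continuousOn
    have hgne : g φ₀ ≠ 0 := by
      intro h0
      have h1 := hk φ₀ hφ₀.1 h0
      have h2 : (k : ℝ) * φ₀ y ≤ (k : ℝ) * φ₀ x + 1 := hφ₀.2
      linarith [mul_sub (k : ℝ) (φ₀ y) (φ₀ x)]
    have hδ : 0 < g φ₀ := lt_of_le_of_ne (hg0 φ₀ hφ₀.1) (Ne.symm hgne)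
    obtain ⟨n, hn⟩ : ∃ n : ℕ, (k : ℝ) * rankOf le x + 1 ≤ n * g φ₀ := by
      obtain ⟨n, hn⟩ := exists_nat_ge (((k : ℝ) * rankOf le x + 1) / g φ₀)
      exact ⟨n, by rwa [div_le_iff₀ hδ] at hn⟩
    refine ⟨k, n, fun φ hφ => ?_⟩
    have hxR : φ x ≤ rankOf le x := hφ.le_rankOf h x
    have hy0 : 0 ≤ φ y := hφ.nonneg h y
    have hn0 : (0 : ℝ) ≤ n := Nat.cast_nonneg n
    have hk0 : (0 : ℝ) ≤ k := Nat.cast_nonneg k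
    have hgφ : 0 ≤ g φ := hg0 φ hφ
    by_cases hc : (k : ℝ) * φ y ≤ (k : ℝ) * φ x + 1
    · have h3 : g φ₀ ≤ g φ :=
        hmin (⟨hφ, hc⟩ : φ ∈ {φ : S → ℝ | IsSpectralPoint le φ} ∩
          {φ | (k : ℝ) * φ y ≤ (k : ℝ) * φ x + 1})
      have h4 : (n : ℝ) * g φ₀ ≤ n * g φ := mul_le_mul_of_nonneg_left h3 hn0
      have h5 : (k : ℝ) * φ x ≤ k * rankOf le x := mul_le_mul_of_nonneg_left hxR hk0
      have h6 : (0 : ℝ) ≤ k * φ y := mul_nonneg hk0 hy0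
      linarith
    · push Not at hc
      have h7 : (0 : ℝ) ≤ n * g φ := mul_nonneg hn0 hgφ
      linarith
  · refine ⟨k, 0, fun φ hφ => ?_⟩
    have hc : ¬ ((k : ℝ) * φ y ≤ (k : ℝ) * φ x + 1) := fun hc => hne ⟨φ, hφ, hc⟩
    push Not at hc
    rw [Nat.cast_zero, zero_mul, add_zero]
    exact hc.le

/-! ## §2  Faces of valid inequalities: attainment and the integer normal forms -/

/-- The face `Z(u,v) = {φ ∈ X : φ(u) = φ(v)}` is compact. [cite: Zuiddam2018, Thm. 2.15] -/
theorem isCompact_face (h : IsStrassenPreorder le) (u v : S) :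
    IsCompact ({φ : S → ℝ | IsSpectralPoint le φ} ∩ {φ | φ u = φ v}) :=
  h.isCompact_setOf_isSpectralPoint.inter_right
    (isClosed_eq (continuous_apply u) (continuous_apply v))

/-- **Maximum attained on a (nonempty) face.** [cite: Zuiddam2018, Thm. 2.15] -/
theorem exists_face_isMaxOn (h : IsStrassenPreorder le) {u v : S}
    (hne : ∃ φ : S → ℝ, IsSpectralPoint le φ ∧ φ u = φ v) (b : S) :
    ∃ φ : S → ℝ, IsSpectralPoint le φ ∧ φ u = φ v ∧
      ∀ ψ, IsSpectralPoint le ψ → ψ u = ψ v → ψ b ≤ φ b := by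
  obtain ⟨φ₁, hφ₁, hφ₁f⟩ := hne
  obtain ⟨φ, hφ, hmax⟩ := (isCompact_face h u v).exists_isMaxOn ⟨φ₁, hφ₁, hφ₁f⟩
    (continuous_apply b).continuousOn
  exact ⟨φ, hφ.1, hφ.2, fun ψ hψ hψf => hmax ⟨hψ, hψf⟩⟩

/-- **Minimum attained on a (nonempty) face.** [cite: Zuiddam2018, Thm. 2.15] -/
theorem exists_face_isMinOn (h : IsStrassenPreorder le) {u v : S}
    (hne : ∃ φ : S → ℝ, IsSpectralPoint le φ ∧ φ u = φ v) (b : S) :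
    ∃ φ : S → ℝ, IsSpectralPoint le φ ∧ φ u = φ v ∧
      ∀ ψ, IsSpectralPoint le ψ → ψ u = ψ v → φ b ≤ ψ b := by
  obtain ⟨φ₁, hφ₁, hφ₁f⟩ := hne
  obtain ⟨φ, hφ, hmin⟩ := (isCompact_face h u v).exists_isMinOn ⟨φ₁, hφ₁, hφ₁f⟩
    (continuous_apply b).continuousOn
  exact ⟨φ, hφ.1, hφ.2, fun ψ hψ hψf => hmin ⟨hψ, hψf⟩⟩

/-- **One multiplier for a face inequality**: if `u ≼~ v` is valid and `φ(x) ≤ φ(y)` on its face,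
then `x + n·u ≼~ y + n·v + 1` for some `n ∈ ℕ`. [cite: Zuiddam2018, Thm. 2.12, Thm. 2.15] -/
theorem asympLe_of_faceLe (h : IsStrassenPreorder le) {u v x y : S}
    (hval : ∀ φ, IsSpectralPoint le φ → φ u ≤ φ v)
    (H : ∀ φ, IsSpectralPoint le φ → φ u = φ v → φ x ≤ φ y) :
    ∃ n : ℕ, AsympLe le (x + (n : S) * u) (y + (n : S) * v + 1) := by
  obtain ⟨n, hn⟩ := exists_multiplier_of_zeroSetLe h (g := fun φ => φ v - φ u)
    ((continuous_apply v).sub (continuous_apply u)) (fun φ hφ => sub_nonneg.2 (hval φ hφ))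
    (fun φ hφ h0 => H φ hφ (sub_eq_zero.1 h0).symm)
  refine ⟨n, h.asympLe_of_forall_spectralPoint _ _ fun φ hφ => ?_⟩
  simp only [hφ.map_add, hφ.map_mul, hφ.map_natCast, hφ.map_one]
  have h1 := hn φ hφ
  linarith [mul_sub (n : ℝ) (φ v) (φ u)]

/-- **INTEGER NORMAL FORM OF A FACE INEQUALITY.**  For a valid `u ≼~ v` and any `x, y`:
`(∀ φ ∈ X, φ(u) = φ(v) → φ(x) ≤ φ(y)) ⟺ ∀ k, ∃ n, k·x + n·u ≼~ k·y + n·v + 1`.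
[cite: Zuiddam2018, Thm. 2.12, Thm. 2.15; Strassen1988, Thm. 2.4] -/
theorem faceLe_iff_family (h : IsStrassenPreorder le) (u v x y : S)
    (hval : ∀ φ, IsSpectralPoint le φ → φ u ≤ φ v) :
    (∀ φ, IsSpectralPoint le φ → φ u = φ v → φ x ≤ φ y) ↔
    ∀ k : ℕ, ∃ n : ℕ,
      AsympLe le ((k : S) * x + (n : S) * u) ((k : S) * y + (n : S) * v + 1) := by
  constructor
  · intro H k
    exact asympLe_of_faceLe h hval (x := (k : S) * x) (y := (k : S) * y) fun φ hφ hφf => by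
      rw [hφ.map_mul, hφ.map_mul, hφ.map_natCast]
      exact mul_le_mul_of_nonneg_left (H φ hφ hφf) (Nat.cast_nonneg k)
  · intro H φ hφ hφf
    refine le_of_forall_pos_lt_add fun ε hε => ?_
    obtain ⟨k, hk⟩ := exists_nat_gt (1 / ε)
    obtain ⟨n, hle⟩ := H k
    have hineq := (h.asympLe_iff_forall_spectralPoint.1 hle) φ hφ
    simp only [hφ.map_add, hφ.map_mul, hφ.map_natCast, hφ.map_one, hφf] at hineq
    have hk0 : (0 : ℝ) < k := lt_trans (by positivity) hk
    have h1 : (k : ℝ) * (φ x - φ y) ≤ 1 := by linarith [mul_sub (k : ℝ) (φ x) (φ y)]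
    have h2 : 1 < (k : ℝ) * ε := by
      have := (div_lt_iff₀ hε).1 hk
      linarith
    by_contra hcon
    push Not at hcon
    have h3 : (k : ℝ) * ε ≤ (k : ℝ) * (φ x - φ y) :=
      mul_le_mul_of_nonneg_left (by linarith) hk0.le
    linarith

/-- **Two multipliers for a STRICT face inequality**: if `u ≼~ v` is valid and `φ(x) < φ(y)` on its
face, then `k·x + n·u + 1 ≼~ k·y + n·v` for some `k, n ∈ ℕ`. [cite: Zuiddam2018, Thm. 2.12, Thm. 2.15] -/
theorem asympLe_of_faceLt (h : IsStrassenPreorder le) {u v x y : S}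
    (hval : ∀ φ, IsSpectralPoint le φ → φ u ≤ φ v)
    (H : ∀ φ, IsSpectralPoint le φ → φ u = φ v → φ x < φ y) :
    ∃ k n : ℕ, AsympLe le ((k : S) * x + (n : S) * u + 1) ((k : S) * y + (n : S) * v) := by
  obtain ⟨k, n, hkn⟩ := exists_multipliers_of_zeroSetLt h (g := fun φ => φ v - φ u)
    ((continuous_apply v).sub (continuous_apply u)) (fun φ hφ => sub_nonneg.2 (hval φ hφ))
    (fun φ hφ h0 => H φ hφ (sub_eq_zero.1 h0).symm)
  refine ⟨k, n, h.asympLe_of_forall_spectralPoint _ _ fun φ hφ => ?_⟩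
  simp only [hφ.map_add, hφ.map_mul, hφ.map_natCast, hφ.map_one]
  have h1 := hkn φ hφ
  linarith [mul_sub (n : ℝ) (φ v) (φ u)]

/-- **INTEGER NORMAL FORM OF A STRICT FACE INEQUALITY.**  For a valid `u ≼~ v` and any `x, y`:
`(∀ φ ∈ X, φ(u) = φ(v) → φ(x) < φ(y)) ⟺ ∃ k n, k·x + n·u + 1 ≼~ k·y + n·v`.
[cite: Zuiddam2018, Thm. 2.12, Thm. 2.15; Strassen1988, Thm. 2.4] -/
theorem faceLt_iff_family (h : IsStrassenPreorder le) (u v x y : S)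
    (hval : ∀ φ, IsSpectralPoint le φ → φ u ≤ φ v) :
    (∀ φ, IsSpectralPoint le φ → φ u = φ v → φ x < φ y) ↔
    ∃ k n : ℕ, AsympLe le ((k : S) * x + (n : S) * u + 1) ((k : S) * y + (n : S) * v) := by
  constructor
  · exact asympLe_of_faceLt h hval
  · rintro ⟨k, n, hle⟩ φ hφ hφf
    have hineq := (h.asympLe_iff_forall_spectralPoint.1 hle) φ hφ
    simp only [hφ.map_add, hφ.map_mul, hφ.map_natCast, hφ.map_one, hφf] at hineq
    have hk0 : (0 : ℝ) ≤ k := Nat.cast_nonneg k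
    by_contra hge
    push Not at hge
    linarith [mul_le_mul_of_nonneg_left hge hk0]

/-! ## §3  The LINEAR catalytic normal form of a strict top-fibre inequality (critic g34 s1) -/

/-- **Strict top-fibre inequalities are witnessed LINEARLY on all of `X`**:
`(∀ φ ∈ X with φ(a) = R̃(a), φ(x) < φ(y)) ⟺ ∃ n L ∈ ℕ, ∀ φ ∈ X, n·φ(x) + L·φ(a) + 1 ≤ n·φ(y) + L·R̃(a)`
(the strict core with `g = R̃(a) − φ(a)`). [cite: Zuiddam2018, Cor. 2.13, Thm. 2.15] -/
theorem topLt_iff_linear (h : IsStrassenPreorder le) (a x y : S) :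
    (∀ φ, IsSpectralPoint le φ → φ a = asympRankOf le a → φ x < φ y) ↔
    ∃ n L : ℕ, ∀ φ, IsSpectralPoint le φ →
      (n : ℝ) * φ x + L * φ a + 1 ≤ n * φ y + L * asympRankOf le a := by
  constructor
  · intro H
    obtain ⟨k, n, hkn⟩ := exists_multipliers_of_zeroSetLt h
      (g := fun φ => asympRankOf le a - φ a) (continuous_const.sub (continuous_apply a))
      (fun φ hφ => sub_nonneg.2 (hφ.le_asympRankOf h a))
      (fun φ hφ h0 => H φ hφ (by linarith [sub_eq_zero.1 h0]))
    refine ⟨k, n, fun φ hφ => ?_⟩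
    have h1 := hkn φ hφ
    linarith [mul_sub (n : ℝ) (asympRankOf le a) (φ a)]
  · rintro ⟨n, L, hnL⟩ φ hφ hφa
    have h1 := hnL φ hφ
    rw [hφa] at h1
    have hn0 : (0 : ℝ) ≤ n := Nat.cast_nonneg n
    by_contra hge
    push Not at hge
    linarith [mul_le_mul_of_nonneg_left hge hn0]

/-- **LINEAR CATALYTIC NORMAL FORM** (one pair `(n, L)`, catalyst `L·k` linear in the level `k`):
`(∀ top φ, φ(x) < φ(y)) ⟺ ∃ n L, ∀ k, ∃ r ≤ L·k·R̃(a) + 2, k·(n·x + 1) + (L·k)·a ≼~ k·(n·y) + r`.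
[cite: Zuiddam2018, Thm. 2.12, Cor. 2.13, Thm. 2.15] -/
theorem topLt_iff_linear_catalytic (h : IsStrassenPreorder le) (a x y : S) :
    (∀ φ, IsSpectralPoint le φ → φ a = asympRankOf le a → φ x < φ y) ↔
    ∃ n L : ℕ, ∀ k : ℕ, ∃ r : ℕ, (r : ℝ) ≤ L * k * asympRankOf le a + 2 ∧
      AsympLe le ((k : S) * ((n : S) * x + 1) + ((L * k : ℕ) : S) * a)
        ((k : S) * ((n : S) * y) + (r : S)) := by
  rw [topLt_iff_linear h a x y]
  have hA0 : 0 ≤ asympRankOf le a := IsStrassenPreorder.asympRankOf_nonneg le a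
  constructor
  · rintro ⟨n, L, hnL⟩
    refine ⟨n, L, fun k => ?_⟩
    obtain ⟨r, hr1, hr2⟩ : ∃ r : ℕ, (L : ℝ) * k * asympRankOf le a ≤ r ∧
        (r : ℝ) ≤ L * k * asympRankOf le a + 2 := by
      have h0 : 0 ≤ (L : ℝ) * k * asympRankOf le a := by positivity
      refine ⟨⌈(L : ℝ) * k * asympRankOf le a⌉₊, Nat.le_ceil _, ?_⟩
      have := Nat.ceil_lt_add_one h0
      linarith
    refine ⟨r, hr2, h.asympLe_of_forall_spectralPoint _ _ fun φ hφ => ?_⟩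
    simp only [hφ.map_add, hφ.map_mul, hφ.map_natCast, hφ.map_one]
    push_cast
    have h1 := hnL φ hφ
    have hk0 : (0 : ℝ) ≤ k := Nat.cast_nonneg k
    have h2 := mul_le_mul_of_nonneg_left h1 hk0
    have e2 : (k : ℝ) * ((n : ℝ) * φ x + L * φ a + 1) = k * (n * φ x + 1) + L * k * φ a := by ring
    have e3 : (k : ℝ) * ((n : ℝ) * φ y + L * asympRankOf le a) =
        k * (n * φ y) + L * k * asympRankOf le a := by ring
    linarith
  · rintro ⟨n, L, H⟩
    refine ⟨n, L, fun φ hφ => ?_⟩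
    refine le_of_forall_pos_lt_add fun ε hε => ?_
    obtain ⟨k, hk⟩ := exists_nat_gt (2 / ε)
    obtain ⟨r, hr, hle⟩ := H k
    have hineq := (h.asympLe_iff_forall_spectralPoint.1 hle) φ hφ
    simp only [hφ.map_add, hφ.map_mul, hφ.map_natCast, hφ.map_one] at hineq
    push_cast at hineq
    have hk0 : (0 : ℝ) < k := lt_trans (by positivity) hk
    have h2 : 2 < (k : ℝ) * ε := by
      have := (div_lt_iff₀ hε).1 hk
      linarith
    by_contra hcon
    push Not at hcon
    have h3 : (k : ℝ) * ε ≤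
        (k : ℝ) * ((n : ℝ) * φ x + L * φ a + 1 - (n * φ y + L * asympRankOf le a)) :=
      mul_le_mul_of_nonneg_left (by linarith) hk0.le
    have e1 : (k : ℝ) * ((n : ℝ) * φ x + L * φ a + 1 - (n * φ y + L * asympRankOf le a)) =
        (k * (n * φ x + 1) + L * k * φ a) - k * (n * φ y) - L * k * asympRankOf le a := by ring
    linarith

end Summit.MatrixMultiplication.MatrixMultiplication.Theorems.OutsiderSandwichFaceLocalisation
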